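import Summits.HubbardSuperconductivity.HubbardSuperconductivity.Theorems.PerWidthThermodynamics.Negative.LadderFermiLocalisation
import Summits.HubbardSuperconductivity.HubbardSuperconductivity.Theorems.PerWidthThermodynamics.Negative.ZeroCouplingCompressibility
import Summits.HubbardSuperconductivity.HubbardSuperconductivity.Theorems.WidthHaldaneLadderPlaneWaves

/-!
# `PerWidthThermodynamics` (stmt-HubbardSuperconductivity-18510), negative side:
# `0 < U` is load-bearing for the STIFFNESS clause — the free isotropic ladder is paramagnetic at
# `θ₀ = π/3` on every odd Fermi sea, cofinally in the length, at every doping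

Stiffness twin of `ZeroCouplingCompressibility` (which kills the compressibility floor `0 < ẽ″` at `U = 0`,
width `4`). With `U := 0` the stiffness clause `d ≤ ρ̃_{L,M}` of the crux already fails at the width
everyone studies first, `M = 2`: whenever the pair number `n = ⌊(1-δ)L⌋` is ODD, the free Fermi sea of the
ladder has exactly one unpaired level `k⋆` (`LadderFermiSea.existsUnique_unpaired`); under the seam twist
`θ` the trial Fermi set (or its mirror image) moves that level DOWN linearly,
`-4 sin(θ/L)·sin(2π|a⋆|/L)` with `sin(2π|a⋆|/L) ≥ 3/8` (`LadderFermiLocalisation`), while the curvature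
cost of all occupied levels is only `4(1 - cos(θ/L))·Σ_F cos ≤ 4(1 - cos(θ/L))·2/sin(π/L)`
(`LadderFold.sum_cos_le`). At `θ₀ = π/3` the gain wins for `L ≥ 100` (`four_mul_loss_sub_gain_neg`:
`0.349/L` against `0.393/L`). Sorry-free:

* `ladderTwistedBand_sub_zero`, `sum_ladderTwistedBand_sub_zero`, `reflected_fermiSet`,
  `tubeEnergy_ladder_twist_sub_le` — `E(θ,2#F) - E(0,2#F) ≤ 4(1-cos(θ/L))Σ_F cos - 4 sin(θ/L)|Σ_F sin|`
  (exact free floor `WidthHaldaneLadderPlaneWaves.tubeEnergy_free_ladder_sub_le`);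
* `four_mul_loss_sub_gain_neg` — the elementary inequality;
* **`tubeStiffness_ladder_zero_coupling_neg`** — `ρ̃_{L,2}(0,δ) < 0` for even `L ≥ 100` whenever
  `n = N_{L,2}(δ)/2` is odd with `3n ≥ 2L + 6`, `n + 6 ≤ L` (a density-`1/2` set of admissible `L`);
* `exists_admissible_tubeStiffness_zero_coupling_neg` (`exists_ge_odd_floor`) and
  **`perWidthThermodynamics_stiffness_false_at_zero_coupling`**: the stiffness clause of the crux with
  `U := 0` is false at every `δ ∈ (0, 3/10)` (which re-derives the compressibility file's headline
  `perWidthThermodynamics_false_at_zero_coupling` through the stiffness clause alone).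

Reading for the crux: BOTH conjuncts of 18510 are interaction effects on the open-shell lengths — any
proof at `(U, δ)` must turn the free ladder's `ρ̃ < 0` (odd `n`, density `1/2` in `L`) into `ρ̃ ≥ d > 0`
for all large `L`, i.e. remove an `O(1/L)` paramagnetic term non-perturbatively in `L` (pair formation;
cf. `Cruxes/PerWidthThermodynamics/Ideas/dilute-pair-anchor.md` §rung 1, where this sign flip is the
first falsifier). Sources: N. Byers, C. N. Yang, PRL 7 (1961) 46; D. J. Scalapino, S. R. White,
S. C. Zhang, PRB 47 (1993) 7995 §II–III (paramagnetic open shells of free clusters); R. M. Noack,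
S. R. White, D. J. Scalapino, Physica C 270 (1996) 281. Folklore; no definitions, no named facts.
-/

noncomputable section

namespace Summit.HubbardSuperconductivity.HubbardSuperconductivity.Theorems.PerWidthThermodynamics.Negative

set_option linter.dupNamespace false -- summit = problem name (single-conjunct summit), D-0017

open scoped BigOperators Classical
open Finset Summit.HubbardSuperconductivity.HubbardSuperconductivity.Theorems.WidthHaldane
open Summit.HubbardSuperconductivity.HubbardSuperconductivity.Theorems.WidthUniformThermodynamics.Negative

/-! ### The twisted band minus the untwisted band, summed; the reflected Fermi set -/

section TwistExpansion

variable {L : ℕ} [NeZero L]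

omit [NeZero L] in
/-- `ε^θ(k) - ε^0(k) = 2cos x (1 - cos(θ/L)) - 2 sin x sin(θ/L)`, `x = 2πa/L`. [folklore] -/
theorem ladderTwistedBand_sub_zero (θ : ℝ) (k : ZMod L × ZMod 2) :
    ladderTwistedBand L θ k - ladderTwistedBand L 0 k =
      2 * Real.cos (2 * Real.pi * (k.1.val : ℝ) / L) * (1 - Real.cos (θ / L)) -
        2 * Real.sin (2 * Real.pi * (k.1.val : ℝ) / L) * Real.sin (θ / L) := by
  rw [ladderTwistedBand, ladderTwistedBand, sub_zero, sub_div, Real.cos_sub]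
  ring

omit [NeZero L] in
/-- The summed form: `Σ_G (ε^θ - ε^0) = 2(1 - cos(θ/L)) Σ_G cos x - 2 sin(θ/L) Σ_G sin x`. [folklore] -/
theorem sum_ladderTwistedBand_sub_zero (θ : ℝ) (G : Finset (ZMod L × ZMod 2)) :
    ∑ k ∈ G, (ladderTwistedBand L θ k - ladderTwistedBand L 0 k) =
      2 * (1 - Real.cos (θ / L)) * ∑ k ∈ G, Real.cos (2 * Real.pi * (k.1.val : ℝ) / L) -
        2 * Real.sin (θ / L) * ∑ k ∈ G, Real.sin (2 * Real.pi * (k.1.val : ℝ) / L) := by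
  simp_rw [ladderTwistedBand_sub_zero]
  rw [Finset.sum_sub_distrib, Finset.mul_sum, Finset.mul_sum]
  congr 1 <;> exact sum_congr rfl fun k _ => by ring

/-- **The reflected Fermi set** `F̄ = {(-a, b) : (a, b) ∈ F}` has the same size, is a Fermi set for the
same level, has the same cosine sum and the opposite sine sum. [folklore] -/
theorem reflected_fermiSet {F : Finset (ZMod L × ZMod 2)} {μ : ℝ}
    (hF : ∀ k ∈ F, ladderTwistedBand L 0 k ≤ μ) (hF' : ∀ k ∉ F, μ ≤ ladderTwistedBand L 0 k) :
    (F.image fun k : ZMod L × ZMod 2 => ((-k.1, k.2) : ZMod L × ZMod 2)).card = F.card ∧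
      (∀ k ∈ F.image (fun k : ZMod L × ZMod 2 => ((-k.1, k.2) : ZMod L × ZMod 2)), ladderTwistedBand L 0 k ≤ μ) ∧
      (∀ k ∉ F.image (fun k : ZMod L × ZMod 2 => ((-k.1, k.2) : ZMod L × ZMod 2)), μ ≤ ladderTwistedBand L 0 k) ∧
      ∑ k ∈ F.image (fun k : ZMod L × ZMod 2 => ((-k.1, k.2) : ZMod L × ZMod 2)),
          Real.cos (2 * Real.pi * (k.1.val : ℝ) / L) = ∑ k ∈ F, Real.cos (2 * Real.pi * (k.1.val : ℝ) / L) ∧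
      ∑ k ∈ F.image (fun k : ZMod L × ZMod 2 => ((-k.1, k.2) : ZMod L × ZMod 2)),
          Real.sin (2 * Real.pi * (k.1.val : ℝ) / L) = -∑ k ∈ F, Real.sin (2 * Real.pi * (k.1.val : ℝ) / L) := by
  have hinj : Function.Injective fun k : ZMod L × ZMod 2 => ((-k.1, k.2) : ZMod L × ZMod 2) := by
    intro k k' h
    simp only [Prod.mk.injEq, neg_inj] at h
    exact Prod.ext h.1 h.2
  have hmem : ∀ k : ZMod L × ZMod 2,
      k ∈ F.image (fun k : ZMod L × ZMod 2 => ((-k.1, k.2) : ZMod L × ZMod 2)) ↔ ((-k.1, k.2) : ZMod L × ZMod 2) ∈ F := by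
    intro k
    rw [mem_image]
    constructor
    · rintro ⟨k', hk', rfl⟩; simpa using hk'
    · intro h; exact ⟨(-k.1, k.2), h, by simp⟩
  refine ⟨card_image_of_injective _ hinj, ?_, ?_, ?_, ?_⟩
  · intro k hk
    rw [← ladderBand_zero_conj]; exact hF _ ((hmem k).1 hk)
  · intro k hk
    rw [← ladderBand_zero_conj]; exact hF' _ (fun h => hk ((hmem k).2 h))
  · rw [sum_image fun k _ k' _ h => hinj h]
    exact sum_congr rfl fun k _ => cos_two_pi_mul_val_neg k.1
  · rw [sum_image fun k _ k' _ h => hinj h, ← sum_neg_distrib]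
    exact sum_congr rfl fun k _ => sin_two_pi_mul_val_neg k.1

end TwistExpansion

/-! ### The elementary inequality: the odd-level gain beats the curvature loss -/

section Elementary

open Real

/-- **Gain beats loss.** For `L ≥ 100`, `C ≤ 2/sin(π/L)` and `σ ≥ 3/8`:
`4(1 - cos(π/3/L))·C - 4 sin(π/3/L)·σ < 0`. With `t = π/L ≤ 0.0315`: the loss is at most
`4·(t²/18)·(2/sin t) ≤ (8/9) t/(1 - t²/6)` and the gain at least `4·(3/8)(t/3 - t³/162)`; the ratio is
`≈ 0.349/0.393`. [folklore] -/
theorem four_mul_loss_sub_gain_neg {Lr C σ : ℝ} (hL : 100 ≤ Lr) (hC : C ≤ 2 / Real.sin (π / Lr))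
    (hσ : 3 / 8 ≤ σ) :
    4 * (1 - Real.cos (π / 3 / Lr)) * C - 4 * Real.sin (π / 3 / Lr) * σ < 0 := by
  have hL0 : 0 < Lr := by linarith
  set t : ℝ := π / Lr with ht
  have ht0 : 0 < t := by positivity
  have ht1 : t ≤ 0.0315 := by
    rw [ht, div_le_iff₀ hL0]; nlinarith [Real.pi_lt_d4]
  have hh : π / 3 / Lr = t / 3 := by rw [ht]; ring
  rw [hh]
  -- `sin t ≥ t(1 - t²/6) > 0`
  have hst : t - t ^ 3 / 6 < Real.sin t := Real.sin_gt_sub_cube ht0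
  have ht2 : t ^ 2 ≤ 1 := by nlinarith
  have ht3 : t ^ 3 ≤ t := by
    calc t ^ 3 = t * t ^ 2 := by ring
      _ ≤ t * 1 := mul_le_mul_of_nonneg_left ht2 ht0.le
      _ = t := mul_one t
  have hst0 : 0 < Real.sin t := by linarith
  -- loss
  have hcos : 1 - Real.cos (t / 3) ≤ t ^ 2 / 18 := by
    have := Real.one_sub_sq_div_two_le_cos (x := t / 3); nlinarith
  have hcos0 : 0 ≤ 1 - Real.cos (t / 3) := by linarith [Real.cos_le_one (t / 3)]
  have hloss : 4 * (1 - Real.cos (t / 3)) * C ≤ 4 * (t ^ 2 / 18) * (2 / Real.sin t) := by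
    have h1 : (1 - Real.cos (t / 3)) * C ≤ (1 - Real.cos (t / 3)) * (2 / Real.sin t) :=
      mul_le_mul_of_nonneg_left hC hcos0
    have h2 : (1 - Real.cos (t / 3)) * (2 / Real.sin t) ≤ (t ^ 2 / 18) * (2 / Real.sin t) :=
      mul_le_mul_of_nonneg_right hcos (by positivity)
    nlinarith
  -- gain
  have hsin3 : t / 3 - (t / 3) ^ 3 / 6 ≤ Real.sin (t / 3) := Real.sin_ge_sub_cube (by positivity)
  have hgain0 : 0 ≤ t / 3 - (t / 3) ^ 3 / 6 := by nlinarith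
  have hgain : 4 * (t / 3 - (t / 3) ^ 3 / 6) * (3 / 8) ≤ 4 * Real.sin (t / 3) * σ := by
    have := mul_le_mul hsin3 hσ (by norm_num) (by linarith)
    nlinarith
  -- comparison: `4 (t²/18)(2/sin t) < 4 (t/3 - (t/3)³/6)(3/8)`
  have hkey : 4 * (t ^ 2 / 18) * (2 / Real.sin t) < 4 * (t / 3 - (t / 3) ^ 3 / 6) * (3 / 8) := by
    rw [show 4 * (t ^ 2 / 18) * (2 / Real.sin t) = (4 * t ^ 2 / 9) / Real.sin t by ring,
      div_lt_iff₀ hst0]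
    -- `4t²/9 < (3/2)(t/3 - t³/162) sin t`, and `sin t > t - t³/6`
    have hpos : 0 < 4 * (t / 3 - (t / 3) ^ 3 / 6) * (3 / 8) := by nlinarith
    have h1 : 4 * (t / 3 - (t / 3) ^ 3 / 6) * (3 / 8) * (t - t ^ 3 / 6) <
        4 * (t / 3 - (t / 3) ^ 3 / 6) * (3 / 8) * Real.sin t := mul_lt_mul_of_pos_left hst hpos
    have ht2 : t ^ 2 ≤ 0.001 := by nlinarith
    have h2 : 4 * t ^ 2 / 9 ≤ 4 * (t / 3 - (t / 3) ^ 3 / 6) * (3 / 8) * (t - t ^ 3 / 6) := by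
      -- divide by `t² > 0`: `4/9 ≤ (3/2)(1/3 - t²/162)(1 - t²/6)`
      have h3 : 4 * (t / 3 - (t / 3) ^ 3 / 6) * (3 / 8) * (t - t ^ 3 / 6) - 4 * t ^ 2 / 9 =
          t ^ 2 * ((3 / 2) * (1 / 3 - t ^ 2 / 162) * (1 - t ^ 2 / 6) - 4 / 9) := by ring
      have h4 : 0 ≤ (3 / 2 : ℝ) * (1 / 3 - t ^ 2 / 162) * (1 - t ^ 2 / 6) - 4 / 9 := by nlinarith
      nlinarith [mul_nonneg (sq_nonneg t) h4]
    linarith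
  linarith

end Elementary

/-! ### The free twist response of an odd Fermi sea is negative -/

section Energy

open Matrix Literature.MathematicalPhysics.QuantumLattice

variable {L : ℕ} [NeZero L] {Λ : Type} [LinearOrder Λ] [Fintype Λ] (e : Λ ≃ ZMod L × ZMod 2)

/-- **Free twist response through the cosine and sine sums.** For a Fermi set `F` of the untwisted
ladder band and every twist `θ`:
`E(θ, 2#F) - E(0, 2#F) ≤ 4(1 - cos(θ/L)) Σ_F cos x - 4 sin(θ/L) |Σ_F sin x|` (trial Fermi set `F` or its
reflection `F̄`, whichever has the sine sum of the right sign; `tubeEnergy_free_ladder_sub_le`). [folklore] -/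
theorem tubeEnergy_ladder_twist_sub_le (hL : 3 ≤ L) (θ : ℝ)
    {F : Finset (ZMod L × ZMod 2)} {μ : ℝ} (hF : ∀ k ∈ F, ladderTwistedBand L 0 k ≤ μ)
    (hF' : ∀ k ∉ F, μ ≤ ladderTwistedBand L 0 k) :
    tubeEnergy L 2 Λ e 0 θ (2 * F.card) - tubeEnergy L 2 Λ e 0 0 (2 * F.card) ≤
      4 * (1 - Real.cos (θ / L)) * ∑ k ∈ F, Real.cos (2 * Real.pi * (k.1.val : ℝ) / L) -
        4 * Real.sin (θ / L) * |∑ k ∈ F, Real.sin (2 * Real.pi * (k.1.val : ℝ) / L)| := by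
  rcases le_or_gt 0 (∑ k ∈ F, Real.sin (2 * Real.pi * (k.1.val : ℝ) / L)) with hS | hS
  · rw [abs_of_nonneg hS]
    have h := tubeEnergy_free_ladder_sub_le e hL θ F μ hF hF'
    rw [sum_ladderTwistedBand_sub_zero] at h
    linarith
  · rw [abs_of_neg hS]
    obtain ⟨hcard, hG, hG', hcos, hsin⟩ := reflected_fermiSet hF hF'
    have h := tubeEnergy_free_ladder_sub_le e hL θ _ μ hG hG'
    rw [sum_ladderTwistedBand_sub_zero, hcard, hcos, hsin] at h
    linarith

/-- The filling of the `L × 2` ladder: `N_{L,2}(δ) = 2⌊(1-δ) L⌋`. [folklore] -/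
theorem tubeFilling_two (L : ℕ) (δ : ℝ) : tubeFilling L 2 δ = 2 * ⌊(1 - δ) * (L : ℝ)⌋₊ := by
  rw [tubeFilling]
  congr 2
  push_cast
  ring

/-- **The free isotropic ladder is paramagnetic on every odd Fermi sea.** For even `L ≥ 100` and a
pair number `n` (`N_{L,2}(δ) = 2n`) which is ODD with `3n ≥ 2L + 6`, `n + 6 ≤ L`:
`ρ̃_{L,2}(0, δ) < 0`. The unpaired Fermi level `k⋆` of the free Fermi sea moves DOWN linearly under
the twist (`-4 sin(π/(3L)) sin(2π|a⋆|/L)`, `sin ≥ 3/8` by `sin_fold_unpaired_ge`), which beats the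
quadratic curvature cost of all occupied levels (`4(1 - cos(π/(3L))) Σ_F cos ≤ (8/9)(π/L)/sin(π/L)·…`,
`sum_cos_le`): `four_mul_loss_sub_gain_neg`. [folklore] -/
theorem tubeStiffness_ladder_zero_coupling_neg (hLe : Even L) (hL : 100 ≤ L) {δ : ℝ} {n : ℕ}
    (hN : tubeFilling L 2 δ = 2 * n) (hodd : Odd n) (h3n : 2 * L + 6 ≤ 3 * n) (hn6 : n + 6 ≤ L) :
    tubeStiffness L 2 Λ e 0 δ < 0 := by
  have hL3 : 3 ≤ L := by omega
  have hL0 : (0 : ℝ) < L := by exact_mod_cast (show 0 < L by omega)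
  have hLr : (100 : ℝ) ≤ L := by exact_mod_cast hL
  -- a Fermi set of the untwisted ladder band with `n` momenta
  obtain ⟨F, μ, hc, hF, hF'⟩ := exists_fermiSet (ladderTwistedBand L 0) (n := n)
    (by rw [Fintype.card_prod, ZMod.card, ZMod.card]; omega)
  -- its unpaired level and the two sums
  obtain ⟨ks, hks, hksc, huniq⟩ := existsUnique_unpaired hF hF' hLe (hc ▸ hodd) (by omega) (by omega)
  have hS := sum_sin_eq_sin_unpaired hLe hks hksc huniq
  have hσ := sin_fold_unpaired_ge hF hF' hLe hL (by omega) (by omega) hks hksc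
  have habs : |∑ k ∈ F, Real.sin (2 * Real.pi * (k.1.val : ℝ) / L)| =
      Real.sin (2 * Real.pi * ((min ks.1.val (L - ks.1.val) : ℕ) : ℝ) / L) := by
    rw [hS, abs_sin_eq_sin_fold]
  have hC := sum_cos_le hL3 F
  -- the energy estimate at `θ₀ = π/3`
  have hθ : 0 ≤ Real.sin (Real.pi / 3 / L) := by
    refine Real.sin_nonneg_of_nonneg_of_le_pi (by positivity) ?_
    rw [div_le_iff₀ hL0]; nlinarith [Real.pi_pos]
  have hE := tubeEnergy_ladder_twist_sub_le e hL3 (Real.pi / 3) hF hF'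
  rw [habs, hc] at hE
  have hneg := four_mul_loss_sub_gain_neg hLr hC hσ
  have hdiff : tubeEnergy L 2 Λ e 0 (Real.pi / 3) (2 * n) - tubeEnergy L 2 Λ e 0 0 (2 * n) < 0 := by
    have : 4 * Real.sin (Real.pi / 3 / L) * (3 / 8) ≤
        4 * Real.sin (Real.pi / 3 / L) * Real.sin (2 * Real.pi * ((min ks.1.val (L - ks.1.val) : ℕ) : ℝ) / L) :=
      mul_le_mul_of_nonneg_left hσ (mul_nonneg (by norm_num) hθ)
    nlinarith
  rw [tubeStiffness, hN]
  refine div_neg_of_neg_of_pos (mul_neg_of_pos_of_neg (by positivity) hdiff) (by positivity)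

/-- **Cofinally many admissible lengths.** For `δ ∈ (0, 3/10)` and every `L₁` there is an even
`L ≥ max(L₁, 100)` whose pair number `⌊(1-δ) L⌋` is odd (`exists_ge_odd_floor` with `β = 2(1-δ)`),
and then `ρ̃_{L,2}(0, δ) < 0` for every carrier. [folklore] -/
theorem exists_admissible_tubeStiffness_zero_coupling_neg {δ : ℝ} (hδ0 : 0 < δ) (hδ1 : δ < 3 / 10)
    (L₁ : ℕ) : ∃ L : ℕ, ∃ _ : NeZero L, Even L ∧ 2 ≤ L ∧ L₁ ≤ L ∧
      ∀ (Λ : Type) [LinearOrder Λ] [Fintype Λ] (e : Λ ≃ ZMod L × ZMod 2),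
        tubeStiffness L 2 Λ e 0 δ < 0 := by
  -- `l ≥ max(L₁, 50, 3/δ)` with `⌊2(1-δ) l⌋` odd
  obtain ⟨l₀, hl₀⟩ := exists_nat_ge (3 / δ)
  obtain ⟨l, hl, hodd⟩ := exists_ge_odd_floor (β := 2 * (1 - δ)) (by linarith) (by linarith) (max (max L₁ 50) l₀)
  have hl50 : 50 ≤ l := ((le_max_right _ _).trans (le_max_left _ _)).trans hl
  have hl1 : L₁ ≤ l := ((le_max_left _ _).trans (le_max_left _ _)).trans hl
  have hll₀ : l₀ ≤ l := (le_max_right _ _).trans hl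
  refine ⟨2 * l, ⟨by omega⟩, even_two_mul l, by omega, by omega, fun Λ _ _ e => ?_⟩
  haveI : NeZero (2 * l) := ⟨by omega⟩
  -- the pair number `n = ⌊(1-δ)(2l)⌋ = ⌊2(1-δ) l⌋`
  have hN : tubeFilling (2 * l) 2 δ = 2 * ⌊2 * (1 - δ) * (l : ℝ)⌋₊ := by
    rw [tubeFilling_two]; congr 2; push_cast; ring
  have hfl := Nat.floor_le (a := 2 * (1 - δ) * l) (by nlinarith)
  have hfl' := Nat.lt_floor_add_one (2 * (1 - δ) * (l : ℝ))
  have hlr : (50 : ℝ) ≤ l := by exact_mod_cast hl50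
  have hδl : 3 ≤ δ * l := by
    rw [div_le_iff₀ hδ0] at hl₀
    have : (l₀ : ℝ) ≤ l := by exact_mod_cast hll₀
    nlinarith
  refine tubeStiffness_ladder_zero_coupling_neg e (even_two_mul l) (by omega) hN hodd ?_ ?_
  · -- `3n ≥ 2L + 6`: `n > 2(1-δ)l - 1 ≥ 1.4 l - 1`
    have : (2 * (2 * l) + 6 : ℕ) < ((3 * ⌊2 * (1 - δ) * (l : ℝ)⌋₊ : ℕ) : ℝ) + 1 := by
      push_cast; nlinarith
    exact_mod_cast Nat.le_of_lt_succ (by exact_mod_cast this)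
  · -- `n + 6 ≤ L`: `n ≤ 2(1-δ) l = 2l - 2δl ≤ 2l - 6`
    have : ((⌊2 * (1 - δ) * (l : ℝ)⌋₊ + 6 : ℕ) : ℝ) ≤ ((2 * l : ℕ) : ℝ) := by
      push_cast; nlinarith
    exact_mod_cast this

/-- **`0 < U` is load-bearing for the STIFFNESS conjunct of `PerWidthThermodynamics`
(stmt-HubbardSuperconductivity-18510).** The stiffness clause of the crux with `U := 0` is FALSE on its
own: at every `δ ∈ (0, 3/10)` the width-`2` member (the free isotropic ladder) has `ρ̃_{L,2}(0,δ) < 0`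
for infinitely many admissible even `L` (the odd Fermi seas), whatever `d > 0` and `L₁`. Companion of
`perWidthThermodynamics_false_at_zero_coupling` (compressibility clause, width `4`): BOTH conjuncts of
18510 are interaction effects on the open-shell lengths. The crux itself (`0 < U`) is untouched. [folklore] -/
theorem perWidthThermodynamics_stiffness_false_at_zero_coupling :
    ¬ ∃ δ ∈ Set.Ioo (0 : ℝ) (3 / 10), ∀ (M : ℕ) [NeZero M], Even M → 2 ≤ M →
        ∃ d : ℝ, 0 < d ∧ ∃ L₁ : ℕ, ∀ (L : ℕ) [NeZero L], Even L → M ≤ L → L₁ ≤ L →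
          ∀ (Λ : Type) [LinearOrder Λ] [Fintype Λ] (e : Λ ≃ ZMod L × ZMod M),
            d ≤ tubeStiffness L M Λ e 0 δ := by
  rintro ⟨δ, ⟨hδ0, hδ1⟩, h⟩
  obtain ⟨d, hd, L₁, h1⟩ := h 2 (by decide) le_rfl
  obtain ⟨L, hL, hLe, hL2, hL1, hneg⟩ := exists_admissible_tubeStiffness_zero_coupling_neg hδ0 hδ1 L₁
  have hle := h1 L hLe hL2 hL1 (Fin (L * 2))
    (finProdFinEquiv.symm.trans (Equiv.prodCongr (ZMod.finEquiv L).toEquiv (ZMod.finEquiv 2).toEquiv))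
  have hlt := hneg (Fin (L * 2))
    (finProdFinEquiv.symm.trans (Equiv.prodCongr (ZMod.finEquiv L).toEquiv (ZMod.finEquiv 2).toEquiv))
  linarith

end Energy

/-! ### On the same lengths the free pair compressibility of the ladder vanishes (appended 2026-08-17,
session 7: the `M = 2` portrait — odd Fermi seas are paramagnetic AND incompressible-floor-free) -/

section Portrait

open Matrix Literature.MathematicalPhysics.QuantumLattice

variable {L : ℕ} [NeZero L] {Λ : Type} [LinearOrder Λ] [Fintype Λ] (e : Λ ≃ ZMod L × ZMod 2)

/-- **Odd Fermi seas are open shells: the free pair compressibility of the ladder vanishes** (even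
`L ≥ 4`, odd `n`, `L/2 + 2 ≤ n < L`): the unpaired level `k⋆` and its empty mirror sit AT the Fermi
level, so `F \ {k⋆} ⊂ F ⊂ F ∪ {mirror}` are nested Fermi seas and `E(N ± 2) - E(N) = ± 2ε(k⋆)`; the
`M = 2` twin of `tubePairCompressibility_zero_coupling_eq_zero_of_openShell` (`M ≥ 3`). [folklore] -/
theorem tubePairCompressibility_ladder_zero_coupling_eq_zero (hLe : Even L) (hL : 4 ≤ L) {δ : ℝ} {n : ℕ}
    (hN : tubeFilling L 2 δ = 2 * n) (hodd : Odd n) (hbig : L / 2 + 2 ≤ n) (hsmall : n < L) :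
    tubePairCompressibility L 2 Λ e 0 δ = 0 := by
  have hL3 : 3 ≤ L := by omega
  obtain ⟨F, μ, hc, hF, hF'⟩ := exists_fermiSet (ladderTwistedBand L 0) (n := n)
    (by rw [Fintype.card_prod, ZMod.card, ZMod.card]; omega)
  obtain ⟨ks, hks, hksc, -⟩ := existsUnique_unpaired hF hF' hLe (hc ▸ hodd) (by omega) (by omega)
  -- the Fermi level is the level of the unpaired momentum
  have hμ : ladderTwistedBand L 0 ks = μ := by
    have h1 := hF ks hks
    have h2 := hF' _ hksc
    rw [ladderBand_zero_conj] at h2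
    linarith
  -- the two neighbouring Fermi seas
  have hplus : tubeEnergy L 2 Λ e 0 0 (2 * (n + 1)) = 2 * ∑ k ∈ F, ladderTwistedBand L 0 k + 2 * μ := by
    have hcard : (insert ((-ks.1, ks.2) : ZMod L × ZMod 2) F).card = n + 1 := by
      rw [card_insert_of_notMem hksc, hc]
    rw [← hcard, tubeEnergy_free_ladder_eq e hL3 0 _ μ, sum_insert hksc, ladderBand_zero_conj, hμ]
    · ring
    · intro k hk
      rcases mem_insert.1 hk with rfl | hk
      · rw [ladderBand_zero_conj, hμ]
      · exact hF k hk
    · intro k hk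
      exact hF' k fun h => hk (mem_insert_of_mem h)
  have hminus : tubeEnergy L 2 Λ e 0 0 (2 * (n - 1)) = 2 * ∑ k ∈ F, ladderTwistedBand L 0 k - 2 * μ := by
    have hcard : (F.erase ks).card = n - 1 := by rw [card_erase_of_mem hks, hc]
    have hsum := Finset.sum_erase_add F (fun k => ladderTwistedBand L 0 k) hks
    rw [← hcard, tubeEnergy_free_ladder_eq e hL3 0 _ μ, ← hsum, hμ]
    · ring
    · intro k hk
      exact hF k (mem_of_mem_erase hk)
    · intro k hk
      by_cases hkk : k = ks
      · rw [hkk, hμ]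
      · exact hF' k fun h => hk (mem_erase.2 ⟨hkk, h⟩)
  have hzero : tubeEnergy L 2 Λ e 0 0 (2 * n) = 2 * ∑ k ∈ F, ladderTwistedBand L 0 k := by
    rw [← hc, tubeEnergy_free_ladder_eq e hL3 0 F μ hF hF']
  have hn1 : 1 ≤ n := hodd.pos
  rw [tubePairCompressibility, hN, show 2 * n + 2 = 2 * (n + 1) by ring,
    show 2 * n - 2 = 2 * (n - 1) by omega, hplus, hminus, hzero]
  ring

/-- **The free ladder violates BOTH floors of 18510 on the same lengths**: for `δ ∈ (0, 3/10)` and every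
`L₁` some even `L ≥ max(L₁, 100)` has `ρ̃_{L,2}(0,δ) < 0` AND `ẽ″_{L,2}(0,δ) = 0` for every carrier. [folklore] -/
theorem exists_admissible_ladder_zero_coupling_paramagnetic_and_incompressible {δ : ℝ} (hδ0 : 0 < δ)
    (hδ1 : δ < 3 / 10) (L₁ : ℕ) : ∃ L : ℕ, ∃ _ : NeZero L, Even L ∧ 2 ≤ L ∧ L₁ ≤ L ∧
      ∀ (Λ : Type) [LinearOrder Λ] [Fintype Λ] (e : Λ ≃ ZMod L × ZMod 2),
        tubeStiffness L 2 Λ e 0 δ < 0 ∧ tubePairCompressibility L 2 Λ e 0 δ = 0 := by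
  obtain ⟨l₀, hl₀⟩ := exists_nat_ge (3 / δ)
  obtain ⟨l, hl, hodd⟩ := exists_ge_odd_floor (β := 2 * (1 - δ)) (by linarith) (by linarith) (max (max L₁ 50) l₀)
  have hl50 : 50 ≤ l := ((le_max_right _ _).trans (le_max_left _ _)).trans hl
  have hl1 : L₁ ≤ l := ((le_max_left _ _).trans (le_max_left _ _)).trans hl
  have hll₀ : l₀ ≤ l := (le_max_right _ _).trans hl
  refine ⟨2 * l, ⟨by omega⟩, even_two_mul l, by omega, by omega, fun Λ _ _ e => ?_⟩
  haveI : NeZero (2 * l) := ⟨by omega⟩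
  have hN : tubeFilling (2 * l) 2 δ = 2 * ⌊2 * (1 - δ) * (l : ℝ)⌋₊ := by
    rw [tubeFilling_two]; congr 2; push_cast; ring
  have hfl := Nat.floor_le (a := 2 * (1 - δ) * l) (by nlinarith)
  have hfl' := Nat.lt_floor_add_one (2 * (1 - δ) * (l : ℝ))
  have hlr : (50 : ℝ) ≤ l := by exact_mod_cast hl50
  have hδl : 3 ≤ δ * l := by
    rw [div_le_iff₀ hδ0] at hl₀
    have : (l₀ : ℝ) ≤ l := by exact_mod_cast hll₀
    nlinarith
  have h3n : 2 * (2 * l) + 6 ≤ 3 * ⌊2 * (1 - δ) * (l : ℝ)⌋₊ := by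
    have : (2 * (2 * l) + 6 : ℕ) < ((3 * ⌊2 * (1 - δ) * (l : ℝ)⌋₊ : ℕ) : ℝ) + 1 := by
      push_cast; nlinarith
    exact_mod_cast Nat.le_of_lt_succ (by exact_mod_cast this)
  have hn6 : ⌊2 * (1 - δ) * (l : ℝ)⌋₊ + 6 ≤ 2 * l := by
    have : ((⌊2 * (1 - δ) * (l : ℝ)⌋₊ + 6 : ℕ) : ℝ) ≤ ((2 * l : ℕ) : ℝ) := by
      push_cast; nlinarith
    exact_mod_cast this
  exact ⟨tubeStiffness_ladder_zero_coupling_neg e (even_two_mul l) (by omega) hN hodd h3n hn6,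
    tubePairCompressibility_ladder_zero_coupling_eq_zero e (even_two_mul l) (by omega) hN hodd (by omega)
      (by omega)⟩

end Portrait

end Summit.HubbardSuperconductivity.HubbardSuperconductivity.Theorems.PerWidthThermodynamics.Negative

end
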